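import Mathlib
import HarnessLib

/-!
# Morphisms agreeing on all field-valued fibres of a flat morphism to a reduced base are equal
# (the fibres are a schematically dense family; EGA IV₃ §11.10)

Topic `Literature/AlgebraicGeometry/Morphisms`; namespace `Literature.AlgebraicGeometry.Morphisms`.  THEOREMS ONLY.
Cell hodgecm-mathlib, fan B, row VI-5 (`AlbaneseTraceOfFiniteQuotient`), package P2 «∇ of a quotient / descent along a
base change of the quotient map», file F1 of the plan announced 2026-08-28T03:45Z.

* `eq_zero_of_forall_minimalPrimes` — ring form: `C` reduced Noetherian, `D` a FLAT `C`-algebra, `x ∈ D` killed by some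
  `s ∉ 𝔭` for every minimal prime `𝔭` of `C`; then `x = 0` (prime avoidance gives one `s ∈ Ann(x)` outside all minimal
  primes, i.e. a non-zero-divisor of the reduced ring `C`, which stays `D`-regular by flatness).
* `eq_zero_of_forall_tmul_residueField_eq_zero` — the same with the hypothesis «`1 ⊗ x = 0` in `κ(𝔭) ⊗_C D` for every
  minimal `𝔭`» (for a minimal prime of a reduced ring, `C_𝔭` is a field, so `κ(𝔭) = C_𝔭` and `κ(𝔭) ⊗_C D = D_𝔭`).
* `hom_ext_of_flat_of_forall_field` — **scheme form**: let `q : S ⟶ T` be FLAT with `T` reduced and locally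
  Noetherian, and `u₁ u₂ : S ⟶ W` two morphisms such that for every field `K` and every `t : Spec K ⟶ T` the composites
  `S ×_T Spec K → S ⇉ W` agree.  Then `u₁ = u₂`.  (The fibres at the residue fields cover `S`, so `u₁ = u₂` on points;
  on affine charts `Spec D ⊆ u₁⁻¹(Spec A) ∩ u₂⁻¹(Spec A) ∩ q⁻¹(Spec C)` the two ring maps `A → D` agree after
  `D → κ(𝔭) ⊗_C D` for all minimal `𝔭 ⊆ C`, hence agree by the ring form.)

Used for: descent of morphisms along the base change `p × T` of a finite-group quotient `p : X → X/Δ` by a reduced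
`k`-scheme `T` (file `Motives/FiniteQuotientProductDescent`).  HC_CM is proved only modulo the 7 printed citations until
rung 0 closes; nothing here changes that.

## References
* A. Grothendieck, EGA IV₃ (Publ. Math. IHÉS 28, 1966), §11.10 «familles schématiquement denses», 11.10.9–11.10.10.
* [Matsumura1987] H. Matsumura, *Commutative Ring Theory*, CUP 1986: Thm. 6.1 and its corollaries (zero-divisors of a
  reduced Noetherian ring = union of the minimal primes), Thm. 7.5 / §7 (flatness and regular elements).
-/

noncomputable section

open CategoryTheory CategoryTheory.Limits AlgebraicGeometry TensorProduct

universe u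

namespace Literature.AlgebraicGeometry.Morphisms

/-! ### Ring form -/

/-- **An element of a flat algebra over a reduced Noetherian ring which dies at every minimal prime is zero.**
If `C` is reduced and Noetherian, `D` is `C`-flat, and for every minimal prime `𝔭` of `C` some `s ∉ 𝔭` kills `x ∈ D`,
then `x = 0`: by prime avoidance the annihilator of `x` contains an element outside all the (finitely many) minimal
primes, i.e. a non-zero-divisor of `C` (the zero-divisors of a reduced ring lie in the union of its minimal primes),
and non-zero-divisors of `C` are `D`-regular by flatness. [cite: Matsumura1987, Thm. 6.1 and §7] -/
theorem eq_zero_of_forall_minimalPrimes {C D : Type*} [CommRing C] [CommRing D] [Algebra C D]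
    [IsReduced C] [IsNoetherianRing C] [Module.Flat C D] (x : D)
    (hx : ∀ p ∈ minimalPrimes C, ∃ s ∉ p, s • x = 0) : x = 0 := by
  classical
  -- the annihilator ideal of `x`
  let I : Ideal C := LinearMap.ker (LinearMap.toSpanSingleton C D x)
  have hI : ∀ s : C, s ∈ I ↔ s • x = 0 := fun s => by
    simp only [I, LinearMap.mem_ker, LinearMap.toSpanSingleton_apply]
  have hfin := minimalPrimes.finite_of_isNoetherianRing C
  -- `I` lies in no minimal prime, hence not in their union (prime avoidance)
  have hnot : ¬ ∃ p ∈ hfin.toFinset, I ≤ p := by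
    rintro ⟨p, hp, hIp⟩
    obtain ⟨s, hs, hsx⟩ := hx p (hfin.mem_toFinset.mp hp)
    exact hs (hIp ((hI s).mpr hsx))
  rw [← Ideal.subset_union_prime (⊥ : Ideal C) ⊥
    (fun p hp _ _ => (hfin.mem_toFinset.mp hp).1.1)] at hnot
  obtain ⟨s, hsI, hs⟩ := Set.not_subset.mp hnot
  have hs' : ∀ p ∈ minimalPrimes C, s ∉ p := fun p hp hsp =>
    hs (Set.mem_iUnion₂.mpr ⟨p, by simpa only [Finset.mem_coe, Set.Finite.mem_toFinset] using hp, hsp⟩)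
  -- `s` is a non-zero-divisor of the reduced ring `C`
  have hs0 : s ∈ nonZeroDivisors C := by
    refine mem_nonZeroDivisors_iff_right.mpr fun c hc => ?_
    have hc' : c ∈ sInf (minimalPrimes C) := by
      rw [Submodule.mem_sInf]
      intro p hp
      exact ((hp.1.1).mem_or_mem (show c * s ∈ p by rw [hc]; exact p.zero_mem)).resolve_right (hs' p hp)
    rw [minimalPrimes, Ideal.sInf_minimalPrimes] at hc'
    exact IsNilpotent.eq_zero hc'
  -- and `D`-regular by flatness
  have hreg := Module.Flat.isSMulRegular_of_nonZeroDivisors (M := D) hs0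
  exact hreg (show s • x = s • (0 : D) by rw [(hI s).mp hsI, smul_zero])

/-- For a MINIMAL prime `𝔭` of a reduced ring `C`, the residue field `κ(𝔭)` is the localization `C_𝔭` (a reduced
zero-dimensional local ring is a field). [cite: Matsumura1987, Thm. 6.1 and §7] -/
theorem isLocalization_atPrime_residueField_of_mem_minimalPrimes {C : Type*} [CommRing C] [IsReduced C]
    (p : Ideal C) [p.IsPrime] (hp : p ∈ minimalPrimes C) : IsLocalization.AtPrime p.ResidueField p := by
  -- `C_𝔭` is a field
  have hsub := IsLocalization.subsingleton_primeSpectrum_of_mem_minimalPrimes p hp (Localization.AtPrime p)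
  have hF : IsField (Localization.AtPrime p) :=
    PrimeSpectrum.subsingleton_iff_isField_of_isReduced.mp hsub
  have hmax : IsLocalRing.maximalIdeal (Localization.AtPrime p) = ⊥ :=
    IsLocalRing.isField_iff_maximalIdeal_eq.mp hF
  -- so the residue map `C_𝔭 → κ(𝔭)` is an isomorphism of `C`-algebras
  have hbij : Function.Bijective (IsLocalRing.residue (Localization.AtPrime p)) := by
    refine ⟨fun a b hab => ?_, IsLocalRing.residue_surjective⟩
    rw [← sub_eq_zero, ← map_sub, IsLocalRing.residue_eq_zero_iff, hmax, Ideal.mem_bot, sub_eq_zero] at hab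
    exact hab
  let e : Localization.AtPrime p ≃ₐ[C] p.ResidueField :=
    AlgEquiv.ofBijective (IsScalarTower.toAlgHom C (Localization.AtPrime p) p.ResidueField) hbij
  exact IsLocalization.isLocalization_of_algEquiv p.primeCompl e

/-- **Residue-field form**: `C` reduced Noetherian, `D` flat over `C`, and `1 ⊗ x = 0` in `κ(𝔭) ⊗_C D` for every minimal
prime `𝔭` of `C`; then `x = 0` (`κ(𝔭) ⊗_C D = D_𝔭` for minimal `𝔭`, so `x` dies in `D_𝔭`, i.e. is killed by some `s ∉ 𝔭`).
[cite: Matsumura1987, Thm. 6.1 and §7] -/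
theorem eq_zero_of_forall_tmul_residueField_eq_zero {C D : Type*} [CommRing C] [CommRing D] [Algebra C D]
    [IsReduced C] [IsNoetherianRing C] [Module.Flat C D] (x : D)
    (hx : ∀ (p : Ideal C) [p.IsPrime], p ∈ minimalPrimes C → (1 : p.ResidueField) ⊗ₜ[C] x = 0) : x = 0 := by
  refine eq_zero_of_forall_minimalPrimes (C := C) x fun p hp => ?_
  haveI : p.IsPrime := hp.1.1
  haveI := isLocalization_atPrime_residueField_of_mem_minimalPrimes p hp
  obtain ⟨s, hs⟩ := (IsLocalizedModule.eq_zero_iff p.primeCompl (TensorProduct.mk C p.ResidueField D 1)).mp (hx p hp)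
  exact ⟨s, s.2, hs⟩

/-! ### Scheme form -/

/-- **Two morphisms which agree on every field-valued fibre of a flat morphism to a reduced, locally Noetherian base are
equal.**  Let `q : S ⟶ T` be flat with `T` reduced and locally Noetherian, and `u₁ u₂ : S ⟶ W` such that for every field
`K` and every `t : Spec K ⟶ T` the two composites `S ×_T Spec K → S → W` agree.  Then `u₁ = u₂` (the family of fibres of
`q` is schematically dense). [cite: Matsumura1987, Thm. 6.1 and §7] -/
theorem hom_ext_of_flat_of_forall_field {S T W : Scheme.{u}} (q : S ⟶ T) [Flat q] [IsReduced T]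
    [IsLocallyNoetherian T] {u₁ u₂ : S ⟶ W}
    (h : ∀ (K : Type u) [Field K] (t : Spec (.of K) ⟶ T),
      pullback.fst q t ≫ u₁ = pullback.fst q t ≫ u₂) : u₁ = u₂ := by
  -- (1) `u₁ = u₂` on points: every point lies on the fibre at the residue field of its image
  have hpt : ∀ s : S, u₁.base s = u₂.base s := by
    intro s
    have hs : s ∈ Set.range (q.fiberι (q.base s)) := by
      rw [Scheme.Hom.range_fiberι]; rfl
    obtain ⟨z, hz⟩ := hs
    have := h (T.residueField (q.base s)) (T.fromSpecResidueField (q.base s))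
    change q.fiberι (q.base s) ≫ u₁ = q.fiberι (q.base s) ≫ u₂ at this
    rw [← hz, ← Scheme.Hom.comp_apply, this, Scheme.Hom.comp_apply]
  -- (2) it suffices to agree on a neighbourhood of each point
  refine Scheme.hom_ext_of_forall u₁ u₂ fun s => ?_
  -- affine charts: `W_c ∋ u s` in `W`, `T_b ∋ q s` in `T`, `S_a ∋ s` inside `u₁⁻¹W_c ∩ u₂⁻¹W_c ∩ q⁻¹T_b`
  obtain ⟨Wc, hWc, hsWc, -⟩ :=
    exists_isAffineOpen_mem_and_subset (X := W) (x := u₁.base s) (U := ⊤) trivial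
  obtain ⟨Tb, hTb, hsTb, -⟩ :=
    exists_isAffineOpen_mem_and_subset (X := T) (x := q.base s) (U := ⊤) trivial
  have hsU : s ∈ u₁ ⁻¹ᵁ Wc ⊓ u₂ ⁻¹ᵁ Wc ⊓ q ⁻¹ᵁ Tb :=
    ⟨⟨hsWc, show u₂.base s ∈ Wc by rw [← hpt s]; exact hsWc⟩, hsTb⟩
  obtain ⟨Sa, hSa, hsSa, hSaU⟩ := exists_isAffineOpen_mem_and_subset (X := S) (x := s) hsU
  have e₁ : Sa ≤ u₁ ⁻¹ᵁ Wc := fun z hz => (hSaU hz).1.1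
  have e₂ : Sa ≤ u₂ ⁻¹ᵁ Wc := fun z hz => (hSaU hz).1.2
  have eq : Sa ≤ q ⁻¹ᵁ Tb := fun z hz => (hSaU hz).2
  refine ⟨Sa, hsSa, ?_⟩
  -- the two ring maps `α_i = u_i♯ : Γ(W, W_c) → D = Γ(S, S_a)`
  set α₁ := u₁.appLE Wc Sa e₁ with hα₁
  set α₂ := u₂.appLE Wc Sa e₂ with hα₂
  -- it suffices that `α₁ = α₂`
  suffices hα : α₁ = α₂ by
    rw [← hSa.isoSpec_hom_fromSpec, Category.assoc, Category.assoc, ← hWc.SpecMap_appLE_fromSpec u₁ hSa e₁,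
      ← hWc.SpecMap_appLE_fromSpec u₂ hSa e₂, ← hα₁, ← hα₂, hα]
  -- the flat algebra `C = Γ(T, T_b) → D = Γ(S, S_a)`
  let C := Γ(T, Tb)
  let D := Γ(S, Sa)
  letI : Algebra C D := (q.appLE Tb Sa eq).hom.toAlgebra
  haveI : Module.Flat C D := HasRingHomProperty.appLE @Flat q ‹_› ⟨Tb, hTb⟩ ⟨Sa, hSa⟩ eq
  haveI : IsNoetherianRing C := IsLocallyNoetherian.component_noetherian ⟨Tb, hTb⟩
  ext w
  rw [← sub_eq_zero]
  refine eq_zero_of_forall_tmul_residueField_eq_zero (C := C) (α₁ w - α₂ w) fun p _ hp => ?_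
  -- the field point `t : Spec κ(𝔭) → T_b ⊆ T` and the map `Spec (κ(𝔭) ⊗_C D) → S ×_T Spec κ(𝔭)`
  let K : Type u := p.ResidueField
  let t : Spec (.of K) ⟶ T := Spec.map (CommRingCat.ofHom (algebraMap C K)) ≫ hTb.fromSpec
  let E : Type u := K ⊗[C] D
  let iD : D →+* E := (Algebra.TensorProduct.includeRight (R := C) (A := K) (B := D)).toRingHom
  let iK : K →+* E := Algebra.TensorProduct.includeLeftRingHom
  have hcomp : (q.appLE Tb Sa eq) ≫ CommRingCat.ofHom iD =
      CommRingCat.ofHom (algebraMap C K) ≫ CommRingCat.ofHom iK := by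
    ext c
    change iD (algebraMap C D c) = iK (algebraMap C K c)
    simp only [iD, iK, AlgHom.toRingHom_eq_coe, RingHom.coe_coe, AlgHom.commutes,
      Algebra.TensorProduct.algebraMap_apply]
    rfl
  let m : Spec (.of E) ⟶ pullback q t :=
    pullback.lift (Spec.map (CommRingCat.ofHom iD) ≫ hSa.fromSpec) (Spec.map (CommRingCat.ofHom iK)) (by
      simp only [t, Category.assoc, ← hTb.SpecMap_appLE_fromSpec q hSa eq, ← Spec.map_comp_assoc, hcomp])
  have hm : m ≫ pullback.fst q t = Spec.map (CommRingCat.ofHom iD) ≫ hSa.fromSpec := pullback.lift_fst _ _ _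
  -- the hypothesis on the fibre at `t`, pulled back along `m` and read through the charts
  have key := h K t
  replace key : Spec.map (CommRingCat.ofHom iD) ≫ hSa.fromSpec ≫ u₁ =
      Spec.map (CommRingCat.ofHom iD) ≫ hSa.fromSpec ≫ u₂ := by
    simpa only [← Category.assoc, hm] using congrArg (fun φ => m ≫ φ) key
  rw [← hWc.SpecMap_appLE_fromSpec u₁ hSa e₁, ← hWc.SpecMap_appLE_fromSpec u₂ hSa e₂, ← hα₁, ← hα₂,
    ← Spec.map_comp_assoc, ← Spec.map_comp_assoc, cancel_mono] at key
  have key' : α₁ ≫ CommRingCat.ofHom iD = α₂ ≫ CommRingCat.ofHom iD := Spec.map_injective key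
  have hw : iD (α₁ w) = iD (α₂ w) := by
    have := congrArg (fun φ => φ.hom w) key'
    simpa only [CommRingCat.hom_comp, RingHom.comp_apply, CommRingCat.hom_ofHom] using this
  change (1 : K) ⊗ₜ[C] (α₁ w - α₂ w) = 0
  rw [tmul_sub, sub_eq_zero]
  exact hw

end Literature.AlgebraicGeometry.Morphisms

end
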